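import Literature.NumberTheory.Automorphic.HarishChandraGLParameterOfCharacter
import Literature.NumberTheory.Automorphic.ClozelAlgebraicityPurityProofs
import HarnessLib

/-!
# The split centre acts through the sum of the archimedean parameter
# (`γ(1) = ∑ x_{τ,i}` for the Harish-Chandra homomorphism of `𝔤𝔩ₙ`; theorems only)

Topic `NumberTheory/Automorphic`; a proof file (theorems only: no definition, no named fact) next to
`HarishChandraGL`, `HarishChandraGLParameterOfCharacter`, `AutomorphicRepDataSplitCenter` and the
`ClozelAlgebraicity*Proofs` files. It supplies the archimedean input ("the central character of
`π_∞` on `A_G` is read off the infinity type") of the normalisation step "we may assume `π`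
unitary" in Clozel 1990, Lemme 4.9 / Patrikis 2019, proof of Cor. 3.2.3, on the carriers of the
tree:

* `sum_rhoGL` — `∑_i ρ_i = 0` for `ρ = ((n-1)/2, …, -(n-1)/2)`.
* `ι_one_mem_center`, **`HarishChandraHomGL.toAlgHom_ι_one`** — the identity matrix `1 ∈ 𝔤𝔩ₙ(𝕜)`
  (`𝕜 = ℝ, ℂ`) is central in `U(𝔤𝔩ₙ(𝕜))`, and **its Harish-Chandra polynomial is
  `γ(1) = ∑_{τ,i} x_{τ,i}`**: on a highest weight vector of weight `λ`, `1 = diag(1, …, 1)` acts by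
  `λ(1) = ∑_{τ,i} λ_{τ,i} = ∑_{τ,i} (λ + ρ)_{τ,i}` (`∑_i ρ_i = 0`); two polynomials agreeing at all
  `λ + ρ` coincide (`eq_of_forall_weight`, the model modules of `HarishChandraGLModel`).
  Knapp 2002, Thm. 5.44 with (5.43).
* `HasHCParameter.apply_one` — **on a `𝔤𝔩ₙ(𝕜)`-module of Harish-Chandra parameter `χ`, the
  central `1` acts by the scalar `∑_τ ∑ χ(τ)`** (`τ` over the real-algebra maps `𝕜 → ℂ`: one for
  `𝕜 = ℝ`, `{id, conj}` for `𝕜 = ℂ`).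
* `sum_embeddings_eq_sum_places` — `∑_{σ : K → ℂ} g(σ) = ∑_{w real} g(σ_w) + ∑_{w complex}
  (g(σ_w) + g(σ̄_w))`; `HasArchParameter.apply_one` — **on a `𝔤𝔩ₙ(K_∞)`-module of archimedean
  parameter `χ` (indexed by the complex embeddings of `K`), `1 ∈ 𝔤𝔩ₙ(K_∞)` acts by
  `∑_{σ : K → ℂ} ∑ χ(σ)`** (`1 = ∑_w 1_w` over the place factors).
* `AutomorphicRepData.HasArchParameter.lieDeriv_one_sub_smul_mem`,
  `AutomorphicRepData.HasInfinityType.lieDeriv_one_sub_smul_mem` — **for an automorphic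
  representation `π = W / W'` of `GL_n(𝔸_K)` with archimedean parameter `χ` (resp. infinity type
  `T`), the Lie derivative along the central `1 ∈ 𝔤 = 𝔤𝔩ₙ(K_∞)` — the generator of the split
  centre `A_G = exp(ℝ · 1)` — acts on `W / W'` by `s = ∑_σ ∑ χ(σ)` (resp. `s = ∑_σ ∑_i a_{σ,i}`)**:
  `1 φ - s φ ∈ W'` for `φ ∈ W`.
* `InfinityType.sum_sum_a_eq_of_pure`,
  `AutomorphicRepData.HasInfinityType.lieDeriv_one_sub_smul_mem_of_pure` — if `T` is pure of weight
  `w` on multisets (clause (iii) of `Clozel1990_regularAlgebraic`: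
  `{a at σ̄} = {w - a : a at σ}`), then `s = n [K:ℚ] w / 2` (`two_mul_sum_sum_a_eq_of_pure`): the
  central character of `π_∞` on `A_G` is `a ↦ a^{n[K:ℚ]w/2}` — for `GL_n(ℝ)` and the parameter
  `z ↦ z^{a_i} z̄^{b_i}` on `ℂˣ ⊂ W_ℝ`, `t ∈ ℝ_{>0} = Nm(√t)` acts by `∏ √t^{a_i+b_i} = t^{nw/2}`, and by
  `t^{nw}` at a complex place (Clozel 1990, §3.3 and Lemme 4.9: `π ⊗ |det|^{-w/2}` is unitary).

## References

* A. W. Knapp, *Lie Groups Beyond an Introduction*, 2nd ed. (2002), §V.5, Thm. 5.44 with (5.43).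
  [Knapp2002]
* L. Clozel, *Motifs et formes automorphes: applications du principe de fonctorialité*, in
  Automorphic forms, Shimura varieties, and L-functions I (Ann Arbor 1988), Academic Press 1990,
  §3.3 and Lemme 4.9. [Clozel1990]
* S. Patrikis, *Variations on a theorem of Tate*, Mem. AMS 258 (2019) = arXiv:1207.6724, proof of
  Cor. 3.2.3 ("we may assume `π` is unitary"). [Patrikis2019]
* A. Borel, H. Jacquet, *Automorphic forms and automorphic representations*, Corvallis 1979, 4.6
  and 5.7. [BorelJacquet1979]
-/

-- Mathlib idiom (Mathlib/Algebra/Lie/OfAssociative.lean): the commutator bracket on associative rings;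
-- needed to state `𝔤𝔩ₙ(𝕜) →ₗ⁅ℝ⁆ End V` (as in `HarishChandraGL`)
attribute [local instance 100] LieRing.ofAssociativeRing

open scoped Matrix Classical

noncomputable section

namespace Literature.NumberTheory.Automorphic

open MvPolynomial HCSpan

/-! ### The Harish-Chandra polynomial of the identity matrix -/

section OnePlace

variable {𝕜 : Type*} [RCLike 𝕜] {n : ℕ}

/-- `2 ∑_{i < n} i = n (n - 1)` in `ℂ`. [folklore] -/
theorem two_mul_sum_natCast_fin (n : ℕ) :
    2 * ∑ i : Fin n, ((i : ℕ) : ℂ) = (n : ℂ) * ((n : ℂ) - 1) := by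
  induction n with
  | zero => simp
  | succ m ih =>
    rw [Fin.sum_univ_castSucc]
    simp only [Fin.val_castSucc, Fin.val_last, Nat.cast_add, Nat.cast_one, mul_add]
    rw [ih]
    ring

variable (n) in
/-- **`∑_i ρ_i = 0`** for `ρ = ((n-1)/2, (n-3)/2, …, -(n-1)/2)` (`rhoGL`). [folklore] -/
theorem sum_rhoGL : ∑ i : Fin n, rhoGL n i = 0 := by
  simp only [rhoGL, Finset.sum_sub_distrib, Finset.sum_const, Finset.card_univ, Fintype.card_fin,
    nsmul_eq_mul]
  linear_combination (-1 / 2 : ℂ) * two_mul_sum_natCast_fin n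

/-- **The identity matrix is central in `U(𝔤𝔩ₙ(𝕜))`** (`[X, 1] = 0`, and an element commuting
with `ι(𝔤)` is central). [folklore] -/
theorem ι_one_mem_center :
    UniversalEnvelopingAlgebra.ι ℝ (1 : Matrix (Fin n) (Fin n) 𝕜) ∈ Subalgebra.center ℝ (UGL 𝕜 n) := by
  refine UniversalEnvelopingAlgebra.mem_center_of_forall_commute_ι fun X => ?_
  have h : UniversalEnvelopingAlgebra.ι ℝ ⁅X, (1 : Matrix (Fin n) (Fin n) 𝕜)⁆ = 0 := by
    rw [Ring.lie_def, mul_one, one_mul, sub_self, map_zero]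
  rw [LieHom.map_lie, Ring.lie_def, sub_eq_zero] at h
  exact h

/-- The weight of the identity: `λ(diag(1, …, 1)) = ∑_{τ,i} λ_{τ,i}`. [folklore] -/
theorem weightFun_one (l : ArchWeightGL 𝕜 n) :
    weightFun l (fun _ : Fin n => (1 : 𝕜)) = ∑ τ : 𝕜 →ₐ[ℝ] ℂ, ∑ i : Fin n, l τ i := by
  simp only [weightFun, map_one, mul_one]

/-- **The Harish-Chandra polynomial of the identity matrix is `∑_{τ,i} x_{τ,i}`**: for every
Harish-Chandra homomorphism `γ` of `𝔤𝔩ₙ(𝕜)`, `γ(1) = ∑_{τ,i} x_{τ,i}`. On the highest weight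
vector of weight `λ` of the model module (`HCModel.hwVec`), `1 = diag(1, …, 1)` acts by
`λ(1) = ∑ λ_{τ,i}`, while `γ(1)` acts by `γ(1)(λ + ρ)`; as `∑_i ρ_i = 0`, the polynomials `γ(1)`
and `∑ x_{τ,i}` agree at every `λ + ρ`, hence are equal (`eq_of_forall_weight`).
Knapp 2002, Thm. 5.44 with (5.43). [cite: Knapp2002, §V.5 Thm. 5.44] -/
theorem HarishChandraHomGL.toAlgHom_ι_one (γ : HarishChandraHomGL 𝕜 n) :
    γ.toAlgHom ⟨UniversalEnvelopingAlgebra.ι ℝ (1 : Matrix (Fin n) (Fin n) 𝕜), ι_one_mem_center⟩ =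
      ∑ p : (𝕜 →ₐ[ℝ] ℂ) × Fin n, X p := by
  classical
  refine eq_of_forall_weight 𝕜 n _ _ fun l => ?_
  have hv := HCModel.isHighestWeightVector_hwVec (𝕜 := 𝕜) l
  have key := γ.highestWeight _ (HCModel.modelRep 𝕜 n).rho l (HCModel.hwVec l) hv
    ⟨UniversalEnvelopingAlgebra.ι ℝ (1 : Matrix (Fin n) (Fin n) 𝕜), ι_one_mem_center⟩
  change UniversalEnvelopingAlgebra.lift ℝ (HCModel.modelRep 𝕜 n).rho
      (UniversalEnvelopingAlgebra.ι ℝ (1 : Matrix (Fin n) (Fin n) 𝕜)) (HCModel.hwVec l) = _ at key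
  have hone : (HCModel.modelRep 𝕜 n).rho 1 (HCModel.hwVec l) =
      weightFun l (fun _ : Fin n => (1 : 𝕜)) • HCModel.hwVec l := by
    have h1 := hv.2.2 (fun _ : Fin n => (1 : 𝕜))
    rwa [Matrix.diagonal_one] at h1
  rw [UniversalEnvelopingAlgebra.lift_ι_apply, hone, weightFun_one] at key
  have h := smul_hwVec_injective 𝕜 n l key
  rw [← h, map_sum]
  simp only [aeval_X]
  rw [Fintype.sum_prod_type]
  simp only [Finset.sum_add_distrib, sum_rhoGL, add_zero]

/-! ### On a module of Harish-Chandra parameter `χ`, `1` acts by `∑_τ ∑ χ(τ)` -/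

variable {V : Type*} [AddCommGroup V] [Module ℂ V]

/-- **On a `𝔤𝔩ₙ(𝕜)`-module of Harish-Chandra parameter `χ`, the identity matrix acts by the scalar
`∑_τ ∑ χ(τ)`**: its infinitesimal character `θ` satisfies `θ(1) = γ(1)(x) = ∑_{τ,i} x_{τ,i}` for any
enumeration `x` of the multisets `χ(τ)` (`HarishChandraHomGL.toAlgHom_ι_one`).
Knapp 2002, Thm. 5.44; Clozel 1990, §3.3. [cite: Knapp2002, §V.5 Thm. 5.44] -/
theorem HasHCParameter.apply_one {ρ : Matrix (Fin n) (Fin n) 𝕜 →ₗ⁅ℝ⁆ Module.End ℂ V}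
    {χ : (𝕜 →ₐ[ℝ] ℂ) → Multiset ℂ} (h : HasHCParameter ρ χ) :
    ρ 1 = algebraMap ℂ (Module.End ℂ V) (∑ τ : 𝕜 →ₐ[ℝ] ℂ, (χ τ).sum) := by
  classical
  obtain ⟨hcard, θ, hθ, hγ⟩ := h
  choose l hl using fun τ => exists_enum_of_card_eq' (χ τ) (hcard τ)
  have h1 := hθ ⟨UniversalEnvelopingAlgebra.ι ℝ (1 : Matrix (Fin n) (Fin n) 𝕜), ι_one_mem_center⟩
  have h2 := hγ (harishChandraHomGL 𝕜 n) l hl ⟨UniversalEnvelopingAlgebra.ι ℝ (1 : Matrix (Fin n) (Fin n) 𝕜), ι_one_mem_center⟩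
  rw [HarishChandraHomGL.toAlgHom_ι_one, map_sum] at h2
  simp only [aeval_X] at h2
  change UniversalEnvelopingAlgebra.lift ℝ ρ (UniversalEnvelopingAlgebra.ι ℝ (1 : Matrix (Fin n) (Fin n) 𝕜)) = _
    at h1
  rw [UniversalEnvelopingAlgebra.lift_ι_apply] at h1
  rw [h1, h2, Fintype.sum_prod_type]
  congr 1
  refine Finset.sum_congr rfl fun τ _ => ?_
  rw [← hl τ, Finset.sum_eq_multiset_sum]

end OnePlace

/-! ### All places: `1 ∈ 𝔤𝔩ₙ(K_∞)` acts by `∑_{σ : K → ℂ} ∑ χ(σ)` -/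

section AllPlaces

open _root_.NumberField _root_.NumberField.InfinitePlace _root_.NumberField.mixedEmbedding

variable {K : Type*} [Field K] [NumberField K] {n : ℕ} {V : Type*} [AddCommGroup V] [Module ℂ V]

/-- `∑_{τ : ℂ →ₐ[ℝ] ℂ} f(τ) = f(id) + f(conj)`. [folklore] -/
theorem sum_algHom_complex {M : Type*} [AddCommMonoid M] (f : (ℂ →ₐ[ℝ] ℂ) → M) :
    ∑ τ : ℂ →ₐ[ℝ] ℂ, f τ = f (AlgHom.id ℝ ℂ) + f (Complex.conjAe : ℂ →ₐ[ℝ] ℂ) := by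
  have hne : AlgHom.id ℝ ℂ ≠ (Complex.conjAe : ℂ →ₐ[ℝ] ℂ) := fun h => by
    have h1 := DFunLike.congr_fun h Complex.I
    have h2 : (Complex.conjAe : ℂ →ₐ[ℝ] ℂ) Complex.I = -Complex.I := Complex.conj_I
    rw [AlgHom.id_apply, h2] at h1
    exact Complex.I_ne_zero (by linear_combination h1 / 2)
  have huniv : (Finset.univ : Finset (ℂ →ₐ[ℝ] ℂ)) =
      ({AlgHom.id ℝ ℂ, (Complex.conjAe : ℂ →ₐ[ℝ] ℂ)} : Finset (ℂ →ₐ[ℝ] ℂ)) := by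
    ext τ
    simp only [Finset.mem_univ, Finset.mem_insert, Finset.mem_singleton, true_iff]
    exact Complex.real_algHom_eq_id_or_conj τ
  rw [huniv, Finset.sum_pair hne]

omit [NumberField K] in
/-- The fibre of a real place under `mk : (K →+* ℂ) → InfinitePlace K` is `{σ_w}`, that of a complex
place is `{σ_w, σ̄_w}` (cf. Mathlib `card_filter_mk_eq`). [folklore] -/
theorem filter_mk_eq [Fintype (K →+* ℂ)] (w : InfinitePlace K)
    {hd : DecidablePred fun φ : K →+* ℂ => mk φ = w} :
    @Finset.filter _ (fun φ : K →+* ℂ => mk φ = w) hd Finset.univ =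
      {w.embedding, ComplexEmbedding.conjugate w.embedding} := by
  ext φ
  simp only [Finset.mem_filter, Finset.mem_univ, true_and, Finset.mem_insert, Finset.mem_singleton]
  constructor
  · intro h
    rw [← mk_embedding w, mk_eq_iff] at h
    rcases h with h | h
    · exact Or.inl h
    · right
      rw [← h, ComplexEmbedding.conjugate, ComplexEmbedding.conjugate, star_star]
  · rintro (rfl | rfl)
    · exact mk_embedding w
    · rw [mk_conjugate_eq, mk_embedding]

/-- **`∑_{σ : K → ℂ} g(σ) = ∑_{w real} g(σ_w) + ∑_{w complex} (g(σ_w) + g(σ̄_w))`**: the complex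
embeddings of a number field grouped by the infinite place they define. [folklore] -/
theorem sum_embeddings_eq_sum_places {M : Type*} [AddCommMonoid M] (g : (K →+* ℂ) → M) :
    ∑ σ : K →+* ℂ, g σ = ∑ w : {w : InfinitePlace K // IsReal w}, g w.1.embedding +
      ∑ w : {w : InfinitePlace K // IsComplex w},
        (g w.1.embedding + g (ComplexEmbedding.conjugate w.1.embedding)) := by
  classical
  rw [← Finset.sum_fiberwise Finset.univ (fun φ : K →+* ℂ => mk φ) g]
  rw [sum_eq_sum_add_sum fun w : InfinitePlace K => ∑ φ ∈ Finset.univ with mk φ = w, g φ]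
  congr 1
  · refine Finset.sum_congr rfl fun w _ => ?_
    rw [filter_mk_eq, ComplexEmbedding.isReal_iff.mp (isReal_iff.mp w.2), Finset.pair_eq_singleton,
      Finset.sum_singleton]
  · refine Finset.sum_congr rfl fun w _ => ?_
    have hne : w.1.embedding ≠ ComplexEmbedding.conjugate w.1.embedding := by
      rw [Ne, eq_comm, ← ComplexEmbedding.isReal_iff, ← isReal_iff]
      exact not_isReal_iff_isComplex.mpr w.2
    rw [filter_mk_eq, Finset.sum_pair hne]

/-- `1 ∈ 𝔤𝔩ₙ(K_∞)` is the sum of the identities of the place factors. [folklore] -/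
theorem one_eq_sum_realPlaceLie_add_sum_complexPlaceLie :
    (1 : Matrix (Fin n) (Fin n) (mixedSpace K)) =
      ∑ w : {w : InfinitePlace K // IsReal w}, realPlaceLie n w 1 +
        ∑ w : {w : InfinitePlace K // IsComplex w}, complexPlaceLie n w 1 := by
  conv_lhs => rw [eq_sum_realPlaceLie_add_sum_complexPlaceLie n (1 : Matrix (Fin n) (Fin n) (mixedSpace K))]
  congr 1
  · refine Finset.sum_congr rfl fun w _ => ?_
    rw [Matrix.map_one (fun a : mixedSpace K => a.1 w) rfl rfl]
  · refine Finset.sum_congr rfl fun w _ => ?_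
    rw [Matrix.map_one (fun a : mixedSpace K => a.2 w) rfl rfl]

end AllPlaces

section ArchParameter

open _root_.NumberField _root_.NumberField.InfinitePlace _root_.NumberField.mixedEmbedding

-- `K : Type` (universe `0`), as for the automorphic data of `AutomorphicRepsGL` and the embedding
-- lemmas `algHomId_toRingHom_comp`, `conjAe_toRingHom_comp` of `ArchParameterUnique`
variable {K : Type} [Field K] [NumberField K] {n : ℕ} {V : Type*} [AddCommGroup V] [Module ℂ V]

/-- **On a `𝔤𝔩ₙ(K_∞)`-module of archimedean parameter `χ`, the identity matrix acts by
`∑_{σ : K → ℂ} ∑ χ(σ)`**: `1 = ∑_w 1_w` over the place factors, `1_w` acts by `∑ χ(σ_w)` at a real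
place and by `∑ χ(σ_w) + ∑ χ(σ̄_w)` at a complex one (`HasHCParameter.apply_one`), and the
embeddings are grouped by places (`sum_embeddings_eq_sum_places`). Clozel 1990, §3.3;
Knapp 2002, Thm. 5.44. [cite: Clozel1990, §3.3] [cite: Knapp2002, §V.5 Thm. 5.44] -/
theorem HasArchParameter.apply_one {ρ : Matrix (Fin n) (Fin n) (mixedSpace K) →ₗ⁅ℝ⁆ Module.End ℂ V}
    {χ : (K →+* ℂ) → Multiset ℂ} (h : HasArchParameter ρ χ) :
    ρ 1 = algebraMap ℂ (Module.End ℂ V) (∑ σ : K →+* ℂ, (χ σ).sum) := by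
  classical
  obtain ⟨hre, hco⟩ := h
  have hr : ∀ w : {w : InfinitePlace K // IsReal w}, ρ (realPlaceLie n w 1) =
      algebraMap ℂ (Module.End ℂ V) ((χ w.1.embedding).sum) := fun w => by
    have h1 := (hre w).apply_one
    rw [LieHom.comp_apply, Fintype.sum_subsingleton _ (Algebra.ofId ℝ ℂ)] at h1
    exact h1
  have hc : ∀ w : {w : InfinitePlace K // IsComplex w}, ρ (complexPlaceLie n w 1) =
      algebraMap ℂ (Module.End ℂ V)
        ((χ w.1.embedding).sum + (χ (ComplexEmbedding.conjugate w.1.embedding)).sum) := fun w => by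
    have h1 := (hco w).apply_one
    rw [LieHom.comp_apply, sum_algHom_complex, algHomId_toRingHom_comp, conjAe_toRingHom_comp] at h1
    exact h1
  rw [one_eq_sum_realPlaceLie_add_sum_complexPlaceLie, map_add, map_sum, map_sum]
  simp only [hr, hc, ← map_sum, ← map_add]
  rw [sum_embeddings_eq_sum_places]

end ArchParameter

/-! ### Automorphic representations of `GL_n(𝔸_K)`: the split centre through the infinity type -/

section Automorphic

open _root_.NumberField _root_.NumberField.mixedEmbedding

variable {K : Type} [Field K] [NumberField K] {n : ℕ} {hcpt : isCompact_glFiniteIntegralLevel n K}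
  {π : AutomorphicRepData (AutomorphyDatum.gl n K hcpt)}

/-- **The central `1 ∈ 𝔤𝔩ₙ(K_∞)` acts on `W / W'` by `∑_σ ∑ χ(σ)`.** If the automorphic
representation `π = W / W'` of `GL_n(𝔸_K)` has archimedean parameter `χ`, then for `φ ∈ W` the
Lie derivative `1 φ` along the central element `1` (the generator of the split centre
`A_G = exp(ℝ · 1) ⊂ GL_n(K_∞)`) satisfies `1 φ - (∑_σ ∑ χ(σ)) φ ∈ W'`: the Lie action on `W / W'`
sends `[φ]` to `[1 φ]` (`HasLieAction`) and is `∑_σ ∑ χ(σ)` on `1` (`HasArchParameter.apply_one`).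
Clozel 1990, §3.3; Borel–Jacquet 1979, 4.6 and 5.7. [cite: Clozel1990, §3.3] [cite: BorelJacquet1979, 4.6] -/
theorem AutomorphicRepData.HasArchParameter.lieDeriv_one_sub_smul_mem {χ : (K →+* ℂ) → Multiset ℂ}
    (h : π.HasArchParameter χ) {φ : (AdelicGroupData.gl n K).Adelic → ℂ} (hφ : φ ∈ π.W) :
    lieDeriv (AutomorphyDatum.gl n K hcpt).ofArch
        (⟨1, trivial⟩ : (AutomorphyDatum.gl n K hcpt).arch.lie) φ -
      (∑ σ : K →+* ℂ, (χ σ).sum) • φ ∈ π.W' := by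
  obtain ⟨ρ𝔤, hρ, hχ⟩ := h
  have h1 := hχ.apply_one
  have h2 := hρ ⟨1, trivial⟩ ⟨φ, hφ⟩
  have h3 : ρ𝔤 ⟨1, trivial⟩ = algebraMap ℂ (Module.End ℂ π.Quot) (∑ σ : K →+* ℂ, (χ σ).sum) := by
    rw [← h1]
    rfl
  rw [h3, Module.algebraMap_end_apply] at h2
  have h4 : π.mkQ (π.lieDerivW ⟨1, trivial⟩ ⟨φ, hφ⟩ - (∑ σ : K →+* ℂ, (χ σ).sum) • ⟨φ, hφ⟩) = 0 := by
    rw [map_sub, map_smul, ← h2, sub_self]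
  have h5 : π.lieDerivW ⟨1, trivial⟩ ⟨φ, hφ⟩ - (∑ σ : K →+* ℂ, (χ σ).sum) • (⟨φ, hφ⟩ : π.W) ∈
      π.kerQuot := (Submodule.Quotient.mk_eq_zero π.kerQuot).1 h4
  exact h5

/-- **The split centre through the infinity type**: if `π = W / W'` has infinity type `T`
(`T σ = {(a_{σ,i}, b_{σ,i})}_i`), then `1 φ - (∑_σ ∑_i a_{σ,i}) φ ∈ W'` for `φ ∈ W`.
Clozel 1990, §3.3. [cite: Clozel1990, §3.3] -/
theorem AutomorphicRepData.HasInfinityType.lieDeriv_one_sub_smul_mem {T : InfinityType K n}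
    (h : π.HasInfinityType T) {φ : (AdelicGroupData.gl n K).Adelic → ℂ} (hφ : φ ∈ π.W) :
    lieDeriv (AutomorphyDatum.gl n K hcpt).ofArch
        (⟨1, trivial⟩ : (AutomorphyDatum.gl n K hcpt).arch.lie) φ -
      (∑ σ : K →+* ℂ, ((T σ).map ArchWeight.a).sum) • φ ∈ π.W' :=
  h.2.lieDeriv_one_sub_smul_mem hφ

/-- **The total `a`-sum of a pure infinity type is `n [K:ℚ] w / 2`** (from
`InfinityType.two_mul_sum_sum_a_eq_of_pure` and `#(K →+* ℂ) = [K:ℚ]`). [cite: Clozel1990, Lemme 4.9] -/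
theorem InfinityType.sum_sum_a_eq_of_pure {T : InfinityType K n}
    (hcard : ∀ ι : K →+* ℂ, Multiset.card (T ι) = n) {w : ℤ}
    (hw : ∀ ι : K →+* ℂ, (T ((starRingEnd ℂ).comp ι)).map ArchWeight.a =
      ((T ι).map ArchWeight.a).map fun a ↦ (w : ℂ) - a) :
    ∑ ι : K →+* ℂ, ((T ι).map ArchWeight.a).sum =
      ((n * Module.finrank ℚ K : ℕ) : ℂ) * w / 2 := by
  have h := InfinityType.two_mul_sum_sum_a_eq_of_pure hcard hw
  rw [NumberField.Embeddings.card K ℂ] at h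
  push_cast
  linear_combination h / 2

/-- **The split centre of a pure representation**: if `π = W / W'` has an infinity type `T` pure of
weight `w` on multisets (`{a at σ̄} = {w - a : a at σ}`, the shape of clause (iii) of
`Clozel1990_regularAlgebraic`), then `1 φ - (n [K:ℚ] w / 2) φ ∈ W'` for `φ ∈ W`: the central
character of `π_∞` on `A_G` is `a ↦ a^{n [K:ℚ] w / 2}` (Clozel 1990, Lemme 4.9: `π ⊗ |det|^{-w/2}`
is unitary; Patrikis 2019, proof of Cor. 3.2.3: "we may assume `π` is unitary").
[cite: Clozel1990, Lemme 4.9] [cite: Patrikis2019, Cor. 3.2.3 (arXiv:1207.6724)] -/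
theorem AutomorphicRepData.HasInfinityType.lieDeriv_one_sub_smul_mem_of_pure {T : InfinityType K n}
    (h : π.HasInfinityType T) {w : ℤ}
    (hw : ∀ ι : K →+* ℂ, (T ((starRingEnd ℂ).comp ι)).map ArchWeight.a =
      ((T ι).map ArchWeight.a).map fun a ↦ (w : ℂ) - a)
    {φ : (AdelicGroupData.gl n K).Adelic → ℂ} (hφ : φ ∈ π.W) :
    lieDeriv (AutomorphyDatum.gl n K hcpt).ofArch
        (⟨1, trivial⟩ : (AutomorphyDatum.gl n K hcpt).arch.lie) φ -
      (((n * Module.finrank ℚ K : ℕ) : ℂ) * w / 2) • φ ∈ π.W' := by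
  rw [← InfinityType.sum_sum_a_eq_of_pure h.1.1 hw]
  exact h.lieDeriv_one_sub_smul_mem hφ

end Automorphic

end Literature.NumberTheory.Automorphic

end
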